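import Summits.BirchSwinnertonDyer.BirchSwinnertonDyer.Theorems.ResidualThetaTransportAtTwoSignedMuAnalyticAtTwoPlusPeriodUnitReading
import Summits.BirchSwinnertonDyer.BirchSwinnertonDyer.Theorems.ResidualThetaTransportAtTwoSignedMuVanishingAtTwoPlusCuspSpanHecke
import Summits.BirchSwinnertonDyer.BirchSwinnertonDyer.Theorems.ManinLocalTwoThreeManinConstantTwentySevenOfCDT
import Summits.BirchSwinnertonDyer.BirchSwinnertonDyer.Theorems.EdixhovenFibreFiveSevenStarredOptimalManinUnitFiveSevenCdtThm1
import HarnessLib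

/-!
# `SignedMuAnalyticAtTwoPlus` (item stmt-BirchSwinnertonDyer-21437) from the Unbounded Denominators theorem — the odd-Eisenstein road

Summit `BirchSwinnertonDyer`, route `ResidualThetaTransportAtTwo` (cell bsd-wall, rung W-ALL/1.hab⁺), crux r401 `SignedMuAnalyticAtTwoPlus`
(stmt-BirchSwinnertonDyer-21437).  Composition by the route pen bsd-wall-p2 g25; landed by LEAD bsd-line-edix-p4 under director-bsd (848)(A).

MECHANISM (every input a tree theorem).  On the habitat⁺ the level `N_W` is odd (good reduction at `2`,
`SignedMuAtTwo.not_two_dvd_conductorNorm_of_goodSS`) and `a₂(W) = 0`, so the Eisenstein number `a₂ − 2 − 1 = −3` of the newform is ODD.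
Ribet 1988 / Ling–Oesterlé 1991 Thm. 6 («the Shimura subgroup is Eisenstein») in period-lattice form, `(a_ℓ − ℓ − 1)Λ₀(f) ⊆ Λ₁(f)` for
`ℓ ∤ N` (`Literature…ModularForms.heckeEigenPeriodCongruence_of_not_dvd`), together with Stevens' inclusion `Λ₁(f) ⊆ Λ_W` obtained from
the Unbounded Denominators theorem, gives `|c₀| = 1` for every lattice-optimal `X₀(N_W)`-datum
(`ManinLocalTwoThree.ManinConstantTwentySeven.abs_maninConstant_eq_one_of_CDT_of_odd_eisenstein`), which is the hypothesis of the landed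
by-name closer `SignedMuAtTwo.PeriodUnitReading.signedMuAnalyticAtTwoPlus_of_forall_not_two_dvd_maninConstant`.  No Manin-constant print fact
(Abbes–Ullmo / Mazur / Česnavičius) is used.

* `signedMuAnalyticAtTwoPlus_of_CDT` — `CalegariDimitrovTang2025_unboundedDenominators → SignedMuAnalyticAtTwoPlus`;
* `signedMuAnalyticAtTwoPlus_holds` — the item BY NAME, from the in-tree term `Theorems.calegariDimitrovTang2025_unboundedDenominators_holds`.

HONEST FRAMING (director-bsd (843)(3) / (848)(C) / (849)(1)(4)).  DEPENDENCY: `signedMuAnalyticAtTwoPlus_holds` rests on the in-tree term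
`Summit.BirchSwinnertonDyer.BirchSwinnertonDyer.Theorems.calegariDimitrovTang2025_unboundedDenominators_holds` — UDC-dependent; audit (P†) pending;
wording of record «kernel-closed (UDC-dependent, audit pending)», never «unconditional».  AS-TYPED vs PRINT: the conclusion CONSUMED here
(`2 ∤ c₀` for a lattice-optimal `X₀(N)`-datum at ODD level `N`) is Abbes–Ullmo 1996 Thm. A at `p = 2` («=» print, obtained by another road);
the INTERMEDIATE `|c₀| = 1` supplied by `abs_maninConstant_eq_one_of_CDT_of_odd_eisenstein` is «⊋ print» at odd levels with an odd square
factor (Manin's conjecture there is open in print) — register it so.  This closes ONE binder of the route's deciding theorem; no BSD leaf,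
rung or class is closed; BSD is proved for no curve by this file; nothing here is an announcement.
[cite: CalegariDimitrovTang2025, Thm. 1.0.1] [cite: LingOesterle1991, Thm. 6] [cite: Ribet1988Shimura, Thm. 1] [cite: Stevens1989, §2]
-/

set_option autoImplicit false
-- the summit-side namespace `Summit.BirchSwinnertonDyer.BirchSwinnertonDyer.…` is the tree's (summit = sub-problem)
set_option linter.dupNamespace false

open CongruenceSubgroup WeierstrassCurve Literature.NumberTheory.EllipticCurves
  Literature.NumberTheory.EllipticCurves.ModularForms Literature.NumberTheory.EllipticCurves.Rank1Residual
  Literature.NumberTheory.Automorphic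
  Summit.BirchSwinnertonDyer.BirchSwinnertonDyer.Theses.ResidualThetaTransportAtTwo

namespace Summit.BirchSwinnertonDyer.BirchSwinnertonDyer.Theorems.SignedMuAtTwo.OfCDT

/-- **`SignedMuAnalyticAtTwoPlus` ⟸ CDT (Unbounded Denominators)**, via `|c₀| = 1` on the habitat⁺ from the odd Eisenstein number `a₂ − 3 = −3`.
[cite: CalegariDimitrovTang2025, Thm. 1.0.1] [cite: LingOesterle1991, Thm. 6] [cite: Stevens1989, §2] -/
theorem signedMuAnalyticAtTwoPlus_of_CDT (hCDT : CalegariDimitrovTang2025_unboundedDenominators) :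
    SignedMuAnalyticAtTwoPlus := by
  refine PeriodUnitReading.signedMuAnalyticAtTwoPlus_of_forall_not_two_dvd_maninConstant ?_
  intro W _ _ hCM hr hss ha hΔ _ f hf W₀ _ _ D₀ hD hopt
  have h2N : ¬ 2 ∣ W.conductorNorm ℤ := not_two_dvd_conductorNorm_of_goodSS hss
  -- `a₂(W₀) = a₂(f) = a₂(W) = 0`
  have hL : W₀.LFunction 2 = 0 := by
    have h1 : cuspCoeff D₀.f 2 = ((W₀.LFunction 2 : ℤ) : ℂ) := D₀.isNewformOf.2 2
    have h2 : cuspCoeff f 2 = ((W.LFunction 2 : ℤ) : ℂ) := hf.2 2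
    have h3 : W.LFunction 2 = W.frobeniusTrace 2 := W.LFunction_apply_prime_eq_frobeniusTrace 2 hss.1
    rw [hD] at h1
    rw [h1, h3, ha] at h2
    exact_mod_cast h2
  have h1 := ManinLocalTwoThree.ManinConstantTwentySeven.abs_maninConstant_eq_one_of_CDT_of_odd_eisenstein
    hCDT D₀ hopt Nat.prime_two h2N (by rw [hL]; exact ⟨-2, by norm_num⟩)
  intro h2
  have : (2 : ℤ) ∣ |D₀.maninConstant| := (dvd_abs 2 D₀.maninConstant).mpr h2
  rw [h1] at this
  omega

/-- **Item stmt-BirchSwinnertonDyer-21437 BY NAME**, from the in-tree Unbounded-Denominators term (audit (P†) pending). BSD is not proved by this.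
[cite: CalegariDimitrovTang2025, Thm. 1.0.1] -/
theorem signedMuAnalyticAtTwoPlus_holds : SignedMuAnalyticAtTwoPlus :=
  signedMuAnalyticAtTwoPlus_of_CDT calegariDimitrovTang2025_unboundedDenominators_holds

end Summit.BirchSwinnertonDyer.BirchSwinnertonDyer.Theorems.SignedMuAtTwo.OfCDT
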